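import Literature.NumberTheory.QuadraticForms.QuadraticNormIndex
import Literature.NumberTheory.QuadraticForms.SquareClassIndex
import Literature.NumberTheory.QuadraticForms.HilbertSymbolArchimedean
import Literature.NumberTheory.GaloisRepresentations.HeckeCharacterWeakApproximation
import HarnessLib

/-!
# The Global Square Theorem from the first inequality (O'Meara 65:15)

Topic `NumberTheory/QuadraticForms`; namespace `Literature`. O'Meara, *Introduction to quadratic forms*,
§65C, Thm. 65:15 (**Global Square Theorem**): *if an element of a global field `F` is a square at
almost all spots on `F`, then it is a square in `F`.* O'Meara's proof is four lines once the first
inequality `(J_F : P_F N_{E/F} J_E) ≥ 2` (65:14) of the quadratic extension `E = F(√θ)` is known: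
were `θ` a non-square which is a local square almost everywhere, the Weak Approximation Theorem
would give, for every idèle `i`, a field element `α` with `α i_𝔭⁻¹` a local square — hence a local
norm from `E` — at the finitely many exceptional spots, while at the other spots *every* element is
a local norm (`θ` being a local square there, `n_𝔭 = 1`); so `J_F = P_F N_{E/F} J_E`
(Example 65:2), contradicting 65:14.

This file carries out exactly this deduction for a number field `K`, in the vocabulary of
`QuadraticNormIndex.lean`: the norm idèles `normIdeles K θ` (the idèles that are local norms from
`K_v(√θ)` everywhere, O'Meara's `N_{E/F} J_E` by Example 65:2), the principal idèles
`principalIdeles K`, and the first inequality as the named fact `two_le_normIdeles_index K`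
(O'Meara 65:14, from the unit index 65:10 via 65:8 and 65:13 — not yet proved in the tree). Main
results:

* `globalSquareTheorem K` — the statement of 65:15 as a named `Prop` (a square at all but
  finitely many finite places is a square; the finitely many infinite places may be discarded
  from "almost all spots");
* `globalSquareTheorem_of_two_le_normIdeles_index : two_le_normIdeles_index K →
  globalSquareTheorem K` — **65:15 follows from 65:14**, fully proved;
* on the way: `isSquare_one_add_four_mul` (`1 + 4𝔪_v ⊆ K_v²` at *every* finite place, Hensel's
  lemma for `Y² + Y - m`; O'Meara 63:1 / 63:8), `isSquare_of_valued_sub_one_lt`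
  (`v(q - 1) < v(4) ⇒ q ∈ K_v²`: the local squares form an open subgroup), and
  `principalIdeles_sup_normIdeles_eq_top_of_eventually_isSquare` — the heart of the argument:
  if `θ ≠ 0` is a square in `K_v` for almost all `v` then `J_K = P_K · normIdeles K θ`.

Weak approximation is the tree's `Literature.NumberTheory.GaloisRepresentations.denseRange_algebraMap_pi_prod`
(`GaloisRepresentations/HeckeCharacterWeakApproximation.lean`, from Mathlib's Artin–Whaples
theorem `AbsoluteValue.denseRange_algebraMap_pi`): `K` is dense in
`(∏_{v ∈ S} K_v) × ∏_{w ∣ ∞} K_w`.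

## References

* O. T. O'Meara, *Introduction to quadratic forms*, Grundlehren 117, Springer (1963), §63A
  (63:1, 63:1b: `F_𝔭²` is open; 63:8), §65A (Example 65:2), §65B (Prop. 65:14), §65C
  (Thm. 65:15 and its proof, PDF p. 186).
-/

noncomputable section

open NumberField IsDedekindDomain Valued Filter Topology

namespace Literature.NumberTheory.QuadraticForms

/-! ### Local squares near `1` (every finite place, dyadic ones included) -/

section LocalSquares

variable (K : Type*) [Field K] [NumberField K] (v : HeightOneSpectrum (𝓞 K))

open Polynomial in
/-- **`1 + 4𝔪_v ⊆ K_v²`** at every finite place `v`: for `m ∈ K_v` with `v(m) < 1`, `1 + 4m` is a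
square — solve `y² + y = m` in `𝒪_v` by Hensel's lemma (`Y² + Y - m` has the simple root `0`
modulo `𝔪_v`) and note `(1 + 2y)² = 1 + 4(y² + y)`. (O'Meara 63:8 (2): `(1 + 𝔭^r)² = 1 + 2𝔭^r`
for `𝔭^r ⊆ 2𝔭`; at a non-dyadic place this is 63:1.) [cite: Omeara1963, §63A Prop. 63:8] -/
theorem isSquare_one_add_four_mul {m : v.adicCompletion K} (hm : Valued.v m < 1) :
    IsSquare (1 + 4 * m) := by
  haveI : HenselianLocalRing 𝒪[v.adicCompletion K] :=
    inferInstanceAs (HenselianLocalRing (v.adicCompletionIntegers K))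
  set M : 𝒪[v.adicCompletion K] := ⟨m, hm.le⟩ with hM
  have hMm : M ∈ IsLocalRing.maximalIdeal 𝒪[v.adicCompletion K] :=
    (mem_maximalIdeal_integer_iff K v M).2 hm
  have hmonic : (X ^ 2 + X - C M : (𝒪[v.adicCompletion K])[X]).Monic := by
    have : (X ^ 2 + X - C M : (𝒪[v.adicCompletion K])[X]) = X ^ 2 + (X - C M) := by ring
    rw [this]
    exact (monic_X_pow 2).add_of_left (by
      rw [degree_X_pow]
      exact (degree_sub_le _ _).trans_lt (by
        rw [max_lt_iff]
        exact ⟨by rw [degree_X]; norm_num, degree_C_le.trans_lt (by norm_num)⟩))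
  have h0 : (X ^ 2 + X - C M : (𝒪[v.adicCompletion K])[X]).eval 0 ∈
      IsLocalRing.maximalIdeal 𝒪[v.adicCompletion K] := by
    simp only [eval_sub, eval_add, eval_pow, eval_X, eval_C, ne_eq, OfNat.ofNat_ne_zero,
      not_false_eq_true, zero_pow, add_zero, zero_sub, neg_mem_iff]
    exact hMm
  have h1 : IsUnit ((derivative (X ^ 2 + X - C M : (𝒪[v.adicCompletion K])[X])).eval 0) := by
    simp
  obtain ⟨y, hy, -⟩ := HenselianLocalRing.is_henselian _ hmonic 0 h0 h1
  simp only [IsRoot.def, eval_sub, eval_add, eval_pow, eval_X, eval_C] at hy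
  -- `y² + y = M`, so `(1 + 2y)² = 1 + 4M`
  have hMc : ((M : 𝒪[v.adicCompletion K]) : v.adicCompletion K) = m := rfl
  have hyM : ((y : 𝒪[v.adicCompletion K]) : v.adicCompletion K) ^ 2 + (y : v.adicCompletion K) =
      m := by
    have h := congrArg (fun z : 𝒪[v.adicCompletion K] ↦ (z : v.adicCompletion K)) hy
    push_cast [hMc] at h
    linear_combination h
  refine ⟨1 + 2 * ((y : 𝒪[v.adicCompletion K]) : v.adicCompletion K), ?_⟩
  linear_combination (-4 : v.adicCompletion K) * hyM

/-- **Local squares form a neighbourhood of `1`**: `v(q - 1) < v(4)` implies `q ∈ K_v²`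
(`q = 1 + 4m` with `v(m) < 1`, `isSquare_one_add_four_mul`). O'Meara 63:1b ("`F_𝔭²` is an open
subset of `F_𝔭`") in quantitative form, valid at dyadic places too.
[cite: Omeara1963, §63A Cor. 63:1b] -/
theorem isSquare_of_valued_sub_one_lt {q : v.adicCompletion K}
    (hq : Valued.v (q - 1) < Valued.v (4 : v.adicCompletion K)) : IsSquare q := by
  haveI : CharZero (v.adicCompletion K) :=
    charZero_of_injective_algebraMap (algebraMap K _).injective
  have h4 : (4 : v.adicCompletion K) ≠ 0 := by norm_num
  have h4pos : 0 < Valued.v (4 : v.adicCompletion K) := (Valuation.pos_iff _).2 h4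
  set m : v.adicCompletion K := (q - 1) / 4 with hm
  have hmv : Valued.v m < 1 := by
    rw [hm, map_div₀, div_lt_one₀ h4pos]
    exact hq
  have hq' : q = 1 + 4 * m := by rw [hm]; field_simp; ring
  rw [hq']
  exact isSquare_one_add_four_mul K v hmv

/-- If `x` is close to `c ≠ 0` in `K_v` — `v(x - c) < v(4c)` — then `x / c` and `c / x` are squares
in `K_v`. [cite: Omeara1963, §63A Cor. 63:1b] -/
theorem isSquare_div_of_valued_sub_lt {x c : v.adicCompletion K} (hc : c ≠ 0)
    (h : Valued.v (x - c) < Valued.v (4 * c)) : IsSquare (x / c) ∧ IsSquare (c / x) := by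
  have hcpos : 0 < Valued.v c := (Valuation.pos_iff _).2 hc
  have h1 : IsSquare (x / c) := by
    refine isSquare_of_valued_sub_one_lt K v ?_
    have : x / c - 1 = (x - c) / c := by field_simp
    rw [this, map_div₀, div_lt_iff₀ hcpos, ← map_mul]
    exact h
  exact ⟨h1, by rw [← inv_div]; exact h1.inv⟩

end LocalSquares

/-! ### Squares at the infinite places -/

section InfinitePlaces

variable {K : Type*} [Field K] {w : InfinitePlace K}

/-- At a complex place every element of `K_w ≃ ℂ` is a square. [folklore] -/
theorem isSquare_completion_of_isComplex (hw : w.IsComplex) (x : w.Completion) : IsSquare x := by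
  let e := InfinitePlace.Completion.ringEquivComplexOfIsComplex hw
  obtain ⟨z, hz⟩ := IsAlgClosed.exists_eq_mul_self (e x)
  have : x = e.symm z * e.symm z := by
    apply e.injective
    rw [map_mul, e.apply_symm_apply, ← hz]
  exact ⟨e.symm z, this⟩

/-- At a real place, an element of `K_w ≃ ℝ` with positive image in `ℝ` is a square. [folklore] -/
theorem isSquare_completion_of_pos (hw : w.IsReal) {x : w.Completion}
    (hx : 0 < InfinitePlace.Completion.ringEquivRealOfIsReal hw x) : IsSquare x := by
  let e := InfinitePlace.Completion.ringEquivRealOfIsReal hw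
  have : x = e.symm (Real.sqrt (e x)) * e.symm (Real.sqrt (e x)) := by
    apply e.injective
    rw [map_mul, e.apply_symm_apply, Real.mul_self_sqrt hx.le]
  exact ⟨_, this⟩

end InfinitePlaces

/-! ### The Global Square Theorem -/

section GST

variable (K : Type) [Field K] [NumberField K]

/-- **Global Square Theorem** (O'Meara, Thm. 65:15): *if an element of a global field is a square
at almost all spots, then it is a square in the field.* Here for the number field `K`:
`θ ∈ K` a square in `K_v` for all but finitely many finite places `v` is a square in `K` (the
infinite places, finitely many, may be omitted from "almost all spots" without changing the
statement). Proved below from the first inequality 65:14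
(`globalSquareTheorem_of_two_le_normIdeles_index`). [cite: Omeara1963, §65C Thm. 65:15] -/
def globalSquareTheorem : Prop :=
  ∀ θ : K, (∀ᶠ v : HeightOneSpectrum (𝓞 K) in cofinite,
    IsSquare (algebraMap K (v.adicCompletion K) θ)) → IsSquare θ

variable {K}

/-- The components of a principal idèle (finite places). [folklore] -/
theorem val_ideleFiniteComponent_principal (v : HeightOneSpectrum (𝓞 K)) (k : Kˣ) :
    (ideleFiniteComponent K v (Units.map (algebraMap K (AdeleRing (𝓞 K) K) : K →* _) k) :
      v.adicCompletion K) = algebraMap K (v.adicCompletion K) k := rfl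

/-- The components of a principal idèle (infinite places). [folklore] -/
theorem val_ideleInfiniteComponent_principal (w : InfinitePlace K) (k : Kˣ) :
    (ideleInfiniteComponent K w (Units.map (algebraMap K (AdeleRing (𝓞 K) K) : K →* _) k) :
      w.Completion) = algebraMap K w.Completion k := rfl

/-- **`J_K = P_K · N` when `θ` is a local square almost everywhere** (the heart of O'Meara's proof of
65:15, via Example 65:2 and weak approximation): let `θ ≠ 0` be a square in `K_v` for all finite
`v` outside a finite set `S`. Given an idèle `i`, weak approximation at `S ∪ ∞`
(`denseRange_algebraMap_pi_prod`) yields `k ∈ Kˣ` with `i_v / k ∈ K_v²` for `v ∈ S` (local squares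
are open, `isSquare_div_of_valued_sub_lt`) and `i_w / k > 0` at the real places; then `k⁻¹ i` is a
local norm from `K_v(√θ)` everywhere — a local square at `S` and at the real places, anything at
the complex places, and at `v ∉ S` every unit is a norm since `θ ∈ K_v²`
(`quadraticNormSubgroup_eq_top_of_isSquare`) — i.e. `k⁻¹ i ∈ normIdeles K θ`.
[cite: Omeara1963, §65C Thm. 65:15 (proof)] -/
theorem principalIdeles_sup_normIdeles_eq_top_of_eventually_isSquare {θ : K} (hθ : θ ≠ 0)
    (hsq : ∀ᶠ v : HeightOneSpectrum (𝓞 K) in cofinite,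
      IsSquare (algebraMap K (v.adicCompletion K) θ)) :
    GaloisRepresentations.principalIdeles K ⊔ normIdeles K θ = ⊤ := by
  classical
  rw [eq_top_iff]
  rintro i -
  -- the finite exceptional set
  have hfin : {v : HeightOneSpectrum (𝓞 K) |
      ¬ IsSquare (algebraMap K (v.adicCompletion K) θ)}.Finite := eventually_cofinite.1 hsq
  set S : Finset (HeightOneSpectrum (𝓞 K)) := hfin.toFinset with hS
  have hS_mem : ∀ v, v ∉ S → IsSquare (algebraMap K (v.adicCompletion K) θ) := fun v hv ↦ by
    by_contra h
    exact hv (hfin.mem_toFinset.2 h)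
  -- components of `i`
  set c : ∀ v : HeightOneSpectrum (𝓞 K), v.adicCompletion K :=
    fun v ↦ (ideleFiniteComponent K v i : v.adicCompletion K) with hc
  have hc0 : ∀ v, c v ≠ 0 := fun v ↦ (ideleFiniteComponent K v i).ne_zero
  set d : ∀ w : InfinitePlace K, w.Completion :=
    fun w ↦ (ideleInfiniteComponent K w i : w.Completion) with hd
  have hd0 : ∀ w, d w ≠ 0 := fun w ↦ (ideleInfiniteComponent K w i).ne_zero
  -- the neighbourhoods
  let U : ∀ v : (S : Type), Set (v.1.adicCompletion K) :=
    fun v ↦ {x | Valued.v (x - c v.1) < Valued.v (4 * c v.1)}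
  let V : ∀ w : InfinitePlace K, Set w.Completion := fun w ↦
    if hw : w.IsReal then
      {x | 0 < InfinitePlace.Completion.ringEquivRealOfIsReal hw x *
        InfinitePlace.Completion.ringEquivRealOfIsReal hw (d w)}
    else {x | x ≠ 0}
  have hU : ∀ v : (S : Type), U v ∈ 𝓝 (c v.1) := by
    intro v
    haveI : CharZero (v.1.adicCompletion K) :=
      charZero_of_injective_algebraMap (algebraMap K _).injective
    have h4 : (4 : v.1.adicCompletion K) ≠ 0 := by norm_num
    have hne : Valued.v.restrict (4 * c v.1) ≠ 0 := by simp [h4, hc0 v.1]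
    rw [Valued.mem_nhds]
    refine ⟨Units.mk0 _ hne, fun y hy ↦ ?_⟩
    rw [Set.mem_setOf_eq, Units.val_mk0] at hy
    exact Valued.v.restrict_lt_iff.mp hy
  have hV : ∀ w : InfinitePlace K, V w ∈ 𝓝 (d w) := by
    intro w
    by_cases hw : w.IsReal
    · simp only [V, dif_pos hw]
      have hcont0 : Continuous (InfinitePlace.Completion.ringEquivRealOfIsReal hw) :=
        (InfinitePlace.Completion.isometryEquivRealOfIsReal hw).continuous
      have hcont : Continuous fun x : w.Completion ↦
          InfinitePlace.Completion.ringEquivRealOfIsReal hw x *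
            InfinitePlace.Completion.ringEquivRealOfIsReal hw (d w) :=
        hcont0.mul continuous_const
      refine (isOpen_lt continuous_const hcont).mem_nhds ?_
      have h0 : InfinitePlace.Completion.ringEquivRealOfIsReal hw (d w) ≠ 0 :=
        (map_ne_zero _).2 (hd0 w)
      exact mul_self_pos.2 h0
    · simp only [V, dif_neg hw]
      exact isOpen_ne.mem_nhds (hd0 w)
  have hUpi : Set.pi Set.univ U ∈ 𝓝 (fun v : (S : Type) ↦ c v.1) :=
    set_pi_mem_nhds Set.finite_univ fun v _ ↦ hU v
  have hVpi : Set.pi Set.univ V ∈ 𝓝 (fun w : InfinitePlace K ↦ d w) :=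
    set_pi_mem_nhds Set.finite_univ fun w _ ↦ hV w
  have hprod : (Set.pi Set.univ U) ×ˢ (Set.pi Set.univ V) ∈
      𝓝 ((fun v : (S : Type) ↦ c v.1), (fun w : InfinitePlace K ↦ d w)) :=
    prod_mem_nhds hUpi hVpi
  -- weak approximation
  obtain ⟨_, ⟨⟨k, rfl⟩, hkU, hkV⟩⟩ :=
    (GaloisRepresentations.denseRange_algebraMap_pi_prod (K := K) S).inter_nhds_nonempty hprod
  simp only [Set.mem_pi, Set.mem_univ, forall_const] at hkU hkV
  have hkU' : ∀ v : (S : Type),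
      Valued.v (algebraMap K (v.1.adicCompletion K) k - c v.1) < Valued.v (4 * c v.1) :=
    fun v ↦ hkU v
  have hkV' : ∀ w : InfinitePlace K, algebraMap K w.Completion k ∈ V w := fun w ↦ hkV w
  -- `k ≠ 0` (look at any infinite place)
  obtain ⟨w₀⟩ : Nonempty (InfinitePlace K) := inferInstance
  have hk0 : k ≠ 0 := by
    rintro rfl
    have h := hkV' w₀
    rw [map_zero] at h
    by_cases hw : w₀.IsReal
    · have h' : (0 : ℝ) < InfinitePlace.Completion.ringEquivRealOfIsReal hw 0 *
          InfinitePlace.Completion.ringEquivRealOfIsReal hw (d w₀) := by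
        simpa only [V, dif_pos hw, Set.mem_setOf_eq] using h
      rw [map_zero, zero_mul] at h'
      exact lt_irrefl _ h'
    · have h' : (0 : w₀.Completion) ≠ 0 := by
        simpa only [V, dif_neg hw, Set.mem_setOf_eq] using h
      exact h' rfl
  set ku : Kˣ := Units.mk0 k hk0 with hkunit
  set a : GaloisRepresentations.ideleGroup K := Units.map (algebraMap K (AdeleRing (𝓞 K) K) : K →* _) ku with ha
  have ha_mem : a ∈ GaloisRepresentations.principalIdeles K := ⟨ku, rfl⟩
  have hθv : ∀ v : HeightOneSpectrum (𝓞 K), algebraMap K (v.adicCompletion K) θ ≠ 0 :=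
    fun v ↦ (map_ne_zero _).2 hθ
  have hθw : ∀ w : InfinitePlace K, algebraMap K w.Completion θ ≠ 0 :=
    fun w ↦ (map_ne_zero _).2 hθ
  -- `a⁻¹ i` is a norm idèle
  have hnorm : a⁻¹ * i ∈ normIdeles K θ := by
    rw [mem_normIdeles_iff]
    refine ⟨fun v ↦ ?_, fun w ↦ ?_⟩
    · haveI : CharZero (v.adicCompletion K) :=
        charZero_of_injective_algebraMap (algebraMap K _).injective
      by_cases hv : v ∈ S
      · -- local square at `v ∈ S`
        apply mem_quadraticNormSubgroup_of_isSquare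
        have hval : ((ideleFiniteComponent K v (a⁻¹ * i) : (v.adicCompletion K)ˣ) :
            v.adicCompletion K) = c v / algebraMap K (v.adicCompletion K) k := by
          rw [map_mul, map_inv, Units.val_mul, Units.val_inv_eq_inv_val, ha,
            val_ideleFiniteComponent_principal]
          rw [div_eq_inv_mul]
          rfl
        rw [hval]
        exact (isSquare_div_of_valued_sub_lt K v (hc0 v) (hkU' ⟨v, hv⟩)).2
      · rw [quadraticNormSubgroup_eq_top_of_isSquare (hS_mem v hv) (hθv v)]
        exact Subgroup.mem_top _
    · haveI : CharZero w.Completion :=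
        charZero_of_injective_algebraMap (algebraMap K _).injective
      apply mem_quadraticNormSubgroup_of_isSquare
      have hval : ((ideleInfiniteComponent K w (a⁻¹ * i) : (w.Completion)ˣ) : w.Completion) =
          (algebraMap K w.Completion k)⁻¹ * d w := by
        rw [map_mul, map_inv, Units.val_mul, Units.val_inv_eq_inv_val, ha,
          val_ideleInfiniteComponent_principal]
        rfl
      rw [hval]
      by_cases hw : w.IsReal
      · have h : 0 < InfinitePlace.Completion.ringEquivRealOfIsReal hw (algebraMap K w.Completion k) *
            InfinitePlace.Completion.ringEquivRealOfIsReal hw (d w) := by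
          simpa only [V, dif_pos hw, Set.mem_setOf_eq] using hkV' w
        apply isSquare_completion_of_pos hw
        rw [map_mul, map_inv₀]
        set e := InfinitePlace.Completion.ringEquivRealOfIsReal hw
        have hek : e (algebraMap K w.Completion k) ≠ 0 := by
          intro h0
          rw [h0, zero_mul] at h
          exact lt_irrefl _ h
        have : (e (algebraMap K w.Completion k))⁻¹ * e (d w) =
            (e (algebraMap K w.Completion k) * e (d w)) /
              (e (algebraMap K w.Completion k)) ^ 2 := by
          field_simp
        rw [this]
        exact div_pos h (by positivity)
      · exact isSquare_completion_of_isComplex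
          (InfinitePlace.not_isReal_iff_isComplex.1 hw) _
  rw [← mul_inv_cancel_left a i]
  exact Subgroup.mul_mem_sup ha_mem hnorm

/-- **The Global Square Theorem follows from the first inequality** (O'Meara's proof of 65:15):
if `θ` were a non-square which is a local square at almost all places, then
`J_K = P_K · N_{E/K} J_E` for `E = K(√θ)`
(`principalIdeles_sup_normIdeles_eq_top_of_eventually_isSquare`), contradicting
`(J_K : P_K N_{E/K} J_E) ≥ 2` (65:14, `two_le_normIdeles_index K`).
[cite: Omeara1963, §65C Thm. 65:15 (proof)] -/
theorem globalSquareTheorem_of_two_le_normIdeles_index (h14 : two_le_normIdeles_index K) :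
    globalSquareTheorem K := by
  intro θ hθ
  by_contra hns
  have hθ0 : θ ≠ 0 := by
    rintro rfl
    exact hns IsSquare.zero
  exact ne_top_of_two_le_normIdeles_index h14 hns
    (principalIdeles_sup_normIdeles_eq_top_of_eventually_isSquare hθ0 hθ)

/-- Contrapositive form used in O'Meara 65:17 and 65:19: under the first inequality, a
non-square of `K` is a non-square in `K_v` for infinitely many finite places `v`.
[cite: Omeara1963, §65C Thm. 65:15] -/
theorem infinite_setOf_not_isSquare_of_two_le_normIdeles_index (h14 : two_le_normIdeles_index K)
    {θ : K} (hθ : ¬ IsSquare θ) :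
    {v : HeightOneSpectrum (𝓞 K) | ¬ IsSquare (algebraMap K (v.adicCompletion K) θ)}.Infinite := by
  intro hfin
  exact hθ (globalSquareTheorem_of_two_le_normIdeles_index h14 θ (eventually_cofinite.2 hfin))

end GST

end Literature.NumberTheory.QuadraticForms
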